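import Literature.NumberTheory.EllipticCurves.PadicSigmaUniquenessProofs
import Literature.NumberTheory.EllipticCurves.CanonicalPAdicHeightParallelogramProofs
import Literature.NumberTheory.EllipticCurves.CanonicalPAdicHeightJunkSigmaProofs
import Literature.NumberTheory.EllipticCurves.CanonicalPAdicHeightKProofs
import HarnessLib

/-!
# The SQUARED Mazur–Tate sigma function `Σ = σ²` and the sigma-squared form of the canonical
# `p`-adic height (`ĥ_p = log_p den x − log_p Σ(z)`) — the `p = 2`-proof receptacle

Topic `Literature/NumberTheory/EllipticCurves` (trunk T-NT-EC); sibling of `PadicSigma.lean` and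
`CanonicalPAdicHeight.lean`. DEFINITIONS WITH BODIES and proved API; NO named fact, nothing asserted
(net literature debt `0`). Typer seat `bsd-goldfeld-ty` g8 of the cell `bsd-goldfeld` (HOME
`run/shared/lean/pub/bsd-goldfeld/`, memo `TY-HYPOTHESES-AT-TWO.md` §10), for the route item
stmt-BirchSwinnertonDyer-19141 (Li–Tian–Yan–Zhu 2025 Thm. 1.1 at `p = 2`).

## Why

The tree pins THE canonical cyclotomic `p`-adic height by the Mazur–Tate sigma formula
`ĥ_p(P) = log_p den x(P) − 2 log_p σ_p(z(P))` (`canonicalPAdicHeight`, `PAdicHeightData.IsCanonical`),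
`σ_p` THE pair `(σ, c)`, `σ = t + ⋯ ∈ tℤ_p⟦t⟧` odd with the sigma ODE (`IsMazurTateSigmaPair`,
Mazur–Stein–Tate 2006 Thm. 1.3 for «`p` an odd prime»). At `p = 2` that pair does NOT exist on the
curves that matter (`2·[t²]σ = a₁`, so `a₁` odd is excluded: `IsMazurTateSigmaPair.norm_a₁_le_norm_two`,
`not_exists_isCanonical_two_of_mordellWeilRank_ne_zero` in `CanonicalPAdicHeightTwoJunkProofs.lean`),
in accordance with print: Silverman, Math. Ann. 332 (2005) §5, Thm. 11 (= Mazur–Tate 1991 Thm. 3.1,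
«assume that `p ≥ 3` … there is a unique power series `σ ∈ z + z²R⟦z⟧` satisfying
`σ(nQ) = σ(Q)^{n²}F_n(Q)`») and **Remark 2**: «Theorem 11 remains true for `p = 2` provided that
everything is squared. That is, there is a unique power series `σ² ∈ z² + z³R⟦z⟧` satisfying
`σ²(nQ) = σ(Q)^{2n²}F_n²(Q)`. But it is not possible to unambiguously take a square root and have (18)
hold for all `n ≥ 1`» (held text `paper:arxiv-math-0404412`, chunk p0011). The height formula only
ever uses `σ²` (`2 log_p σ = log_p σ²`), so the `p`-uniform receptacle is the SQUARE `Σ = σ²`: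

* `sigmaSqG`, `SatisfiesSigmaSqODE W Σ c` — the sigma ODE rewritten for `Σ`: since
  `(1/σ)(dσ/ω) = ½ (1/Σ)(dΣ/ω)`, the equation `x(t) + c = −(d/ω)((1/σ)(dσ/ω))` of MST Thm. 1.3
  reads `2·(x + c) = −(d/ω)((1/Σ)(dΣ/ω))`; poles cleared exactly as in `SatisfiesSigmaODE`
  (write `Σ = t²S`, `G := (2S + tS')(ωS)⁻¹ = t·ΣΣ'/(ωΣ)·…`, then `2ω(t²x + ct²) = G − tG'`);
* `IsFormallyEven W Σ : Σ(i(t)) = Σ(t)` (the square of Mazur–Tate oddness `σ(i(t)) = −σ(t)`);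
* `IsMazurTateSigmaSqPair W Σ c` — `Σ = t² + ⋯ ∈ t²ℤ_p⟦t⟧` (`[t⁰]Σ = [t¹]Σ = 0`, `[t²]Σ = 1`, all
  coefficients in `ℤ_p` = Silverman's «`σ² ∈ z² + z³R⟦z⟧`»), even, sigma-squared ODE for the constant
  `c ∈ ℚ_p` (NO integrality is imposed on `c`: print says nothing about the constant at `p = 2`, and
  `c = (a₁² + 4a₂ − E₂(E,ω))/12` need not be a `2`-adic integer; at odd `p` the tree's pair supplies
  `c ∈ ℤ_p` anyway);
* **PROVED** `IsMazurTateSigmaPair.sq`: a Mazur–Tate pair `(σ, c)` gives the sigma-squared pair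
  `(σ², c)` (any `p`) — the consistency of the receptacle with the tree's odd-`p` vocabulary;
* `mazurTateSqPair`, `padicSigmaSq`, `padicSigmaSqConst` — THE squared pair of `W/ℚ_p`: `(σ_p², c)`
  whenever the Mazur–Tate pair exists (so that at every prime where the tree already has `σ_p`
  nothing new is chosen: `padicSigmaSq_eq_sq_of_exists`), otherwise a chosen sigma-squared pair
  (unique by Mazur–Tate 1991 Thm. 3.1 / Silverman Rem. 2 at a good ordinary `p = 2` — a statement
  NOT vendored here), junk `(t², 0)` if there is none;
* over `ℚ`: `padicSigmaSqEval W p t = Σ_p(t)`, **`canonicalPAdicHeightSq W p P =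
  log_p den x(P) − log_p Σ_p(z(P))`** and the predicate **`PAdicHeightData.IsCanonicalSq D`**
  (`∀ P admissible, ⟨P,P⟩_D = canonicalPAdicHeightSq P`), with the PROVED consistency
  `canonicalPAdicHeightSq_eq_of_exists` / `isCanonicalSq_iff_isCanonical_of_exists`: whenever
  `W ⊗ ℚ_p` has a Mazur–Tate pair (every odd good ordinary `p`: `mazur_tate_sigma_existsUnique_holds`
  for `p ≥ 5`, fact `mazur_tate_sigma_exists_odd` at `p = 3`), `IsCanonicalSq D ↔ IsCanonical D`.

* §2 (append): **`two_mul_coeff_three_of_isFormallyEven`** / **`IsMazurTateSigmaSqPair.coeff_three_eq`**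
  — evenness pins `[t³]Σ = a₁` (the even twin of `2[t²]σ = a₁`): a squared pair forces only
  `a₁ ∈ ℤ_p` (`norm_a₁_le_one`), i.e. the `p = 2` obstruction of the `σ`-vocabulary is absent here;
* §3 (append): the `K`-side twin `canonicalPAdicHeightSqK = log_p N𝔡(x) − Σ_ι log_p Σ_p(z(ιP))`,
  **`PAdicHeightDataK.IsCanonicalSq`** (`p` totally split in `K`), PROVED equal / equivalent to
  `canonicalPAdicHeightK` / `PAdicHeightDataK.IsCanonical` whenever the Mazur–Tate pair exists
  (`p` odd) — the receptacle over `K = ℚ(√−7)` at the split prime `2`.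

So `IsCanonicalSq` agrees with `IsCanonical` wherever the latter is meaningful, and at `p = 2` (good
ordinary, `a₁` odd) it is the predicate «the quadratic form of `D` on admissible points is the
Mazur–Tate `σ²`-formula» — the shape in which a `2`-adic height fact (Bertrand 1984 at `2`, Disegni
2017 Thm. B at `2`, LTYZ 2025 (6.1)/(7.7)) can be typed once the `p = 2` existence of the squared pair
(MT91 Thm. 3.1 at `p = 2`, cite-only acquisitions acq-00916 / acq-01927) is vendored. Nothing in this
file asserts that existence, nor that the `σ²`-formula IS the Schneider / Mazur–Tate 1983 height at
`p = 2` (that identification, printed for the σ-formula at odd `p` in MST 2006 §1, is carried by each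
consumer fact's citation, exactly as for `IsCanonical`).

## Sources

* [MazurSteinTate2006] B. Mazur, W. Stein, J. Tate, Doc. Math. Extra Vol. Coates (2006), §1 eq. (1.1),
  Thm. 1.3, Rem. 1.4.
* [Silverman2005DivPoly] J. H. Silverman, Math. Ann. 332 (2005) 443–471 (arXiv math/0404412), §5
  Thm. 11 and Remark 2.
* [MazurTate1991] B. Mazur, J. Tate, *The `p`-adic sigma function*, Duke Math. J. 62 (1991), Thm. 3.1
  (through Silverman 2005 and MST 2006; not held).
* [SteinWuthrich2013] W. Stein, C. Wuthrich, Math. Comp. 82 (2013), §4.1 eq. (4.1).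
* [Harvey2008] D. Harvey, LMS J. Comput. Math. 11 (2008), §4 (oddness `σ(i(t)) = −σ(t)`).

## Design

* Same pole clearing as `PadicSigma.lean`: with `S = Σ/t²` (`sigmaShift (sigmaShift Σ)`),
  `G = (2S + tS')(ωS)⁻¹ = t·Σ'/(ωΣ)` and `2·ω·(t²x + ct²) = G − tG'`; for `Σ = σ²`, `S = s²` and
  `G = 2g` (`sigmaSqG_sq`), whence `IsMazurTateSigmaPair.sq`.
* `mazurTateSqPair` prefers `(σ_p², c_p)` when the Mazur–Tate pair exists: this makes the odd-`p`
  consistency definitional and never invokes a uniqueness statement for squared pairs.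
* No `[IsGloballyMinimal]` / reduction hypotheses in the definitions (as in `CanonicalPAdicHeight.lean`);
  they belong to the facts.
-/

noncomputable section

open scoped Classical
open PowerSeries Literature.NumberTheory.EllipticCurves

namespace WeierstrassCurve

/-! ### Evenness and the sigma-squared ODE (any commutative ring / `ℚ`-algebra) -/

section Ring

variable {R : Type*} [CommRing R] (W : WeierstrassCurve R)

/-- **Evenness in the Mazur–Tate sense**: `Σ(i(t)) = Σ(t)`, `i = formalNeg` the formal inverse law
(the square of an odd `σ` is even). [Harvey 2008, §4; Silverman 2005, §5 Rem. 2]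
[cite: Silverman2005DivPoly, §5 Rem. 2] -/
def IsFormallyEven (Sq : R⟦X⟧) : Prop :=
  Sq.subst W.formalNeg = Sq

variable {W} in
/-- The square of a Mazur–Tate-odd series is even: `σ(i(t)) = −σ(t) ⇒ σ²(i(t)) = σ²(t)`.
[cite: Silverman2005DivPoly, §5 Rem. 2] -/
theorem IsFormallyOdd.sq {σ : R⟦X⟧} (h : W.IsFormallyOdd σ) : W.IsFormallyEven (σ ^ 2) := by
  unfold IsFormallyEven
  rw [subst_pow W.hasSubst_formalNeg, h, neg_sq]

/-- `sigmaShift (t·f) = f`. [folklore] -/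
private theorem sigmaShift_X_mul (f : R⟦X⟧) : sigmaShift (X * f) = f := by
  ext n
  rw [coeff_sigmaShift, coeff_succ_X_mul]

end Ring

section RatAlgebra

variable {A : Type*} [CommRing A] [Algebra ℚ A] (W : WeierstrassCurve A)

/-- **`G = (2S + tS')·(ωS)⁻¹ = tΣ'/(ωΣ) = t·(d/ω) log Σ`** for `Σ = t²S` (`S = sigmaShift (sigmaShift Σ)`):
the series clearing the poles of `2(x + c) = −(d/ω)((1/Σ)(dΣ/ω))`; for `Σ = σ²` it is `2·sigmaG σ`
(`sigmaSqG_sq`). [Mazur–Stein–Tate 2006, Thm. 1.3; Silverman 2005, §5 Rem. 2] [folklore] -/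
def sigmaSqG (Sq : A⟦X⟧) : A⟦X⟧ :=
  (2 * sigmaShift (sigmaShift Sq) + X * d⁄dX A (sigmaShift (sigmaShift Sq))) *
    invOfUnit (W.formalOmega * sigmaShift (sigmaShift Sq)) 1

/-- **The sigma-squared ODE `2(x(t) + c) = −(d/ω)((1/Σ)(dΣ/ω))`, poles cleared**:
`2·ω·(t²x + ct²) = G − tG'` with `G = sigmaSqG Σ`. This is the Mazur–Stein–Tate equation
`x + c = −(d/ω)((1/σ)(dσ/ω))` (Thm. 1.3) for `Σ = σ²`, using `σ'/σ = ½ Σ'/Σ`.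
[Mazur–Stein–Tate 2006, Thm. 1.3; Silverman 2005, §5 Rem. 2 («everything is squared»)]
[cite: MazurSteinTate2006, Thm. 1.3] [cite: Silverman2005DivPoly, §5 Rem. 2] -/
def SatisfiesSigmaSqODE (Sq : A⟦X⟧) (c : A) : Prop :=
  2 * (W.formalOmega * (W.formalXMulSq + C c * X ^ 2)) = W.sigmaSqG Sq - X * d⁄dX A (W.sigmaSqG Sq)

omit [Algebra ℚ A] in
variable {W} in
/-- `S(σ²) = s²`: the double shift of `σ² = t²s²` is `s²` (`σ = ts`, `σ(0) = 0`). [folklore] -/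
private theorem sigmaShift_sigmaShift_sq {σ : A⟦X⟧} (h0 : constantCoeff σ = 0) :
    sigmaShift (sigmaShift (σ ^ 2)) = sigmaShift σ ^ 2 := by
  have hσ : σ = X * sigmaShift σ := (X_mul_sigmaShift h0).symm
  conv_lhs => rw [hσ, show (X * sigmaShift σ) ^ 2 = X * (X * sigmaShift σ ^ 2) by ring]
  rw [sigmaShift_X_mul, sigmaShift_X_mul]

variable {W} in
/-- **`G(σ²) = 2·g(σ)`**: for `σ = t + ⋯` (`σ(0) = 0`, `σ'(0) = 1`), the pole-cleared series of `σ²`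
is twice that of `σ` (`(s²)' = 2ss'`, and `s·(ωs²)⁻¹ = (ωs)⁻¹`), i.e. `(1/σ)(dσ/ω) = ½(1/Σ)(dΣ/ω)`
for `Σ = σ²`. [Mazur–Stein–Tate 2006, Thm. 1.3 (the ODE); Silverman 2005, §5 Rem. 2 («everything is
squared»)] [cite: MazurSteinTate2006, Thm. 1.3] [cite: Silverman2005DivPoly, §5 Rem. 2] -/
theorem sigmaSqG_sq {σ : A⟦X⟧} (h0 : constantCoeff σ = 0) (h1 : coeff 1 σ = 1) :
    W.sigmaSqG (σ ^ 2) = 2 * W.sigmaG σ := by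
  set s : A⟦X⟧ := sigmaShift σ with hs
  have hS : sigmaShift (sigmaShift (σ ^ 2)) = s ^ 2 := sigmaShift_sigmaShift_sq h0
  -- the two units `U = ω s`, `V = ω s² = U s`
  have hU0 : constantCoeff (W.formalOmega * s) = 1 := W.constantCoeff_formalOmega_mul_sigmaShift h1
  have hs0 : constantCoeff s = 1 := by rw [hs, constantCoeff_sigmaShift, h1]
  have hV0 : constantCoeff (W.formalOmega * s ^ 2) = 1 := by
    rw [pow_two, ← mul_assoc, map_mul, hU0, hs0, one_mul]
  have hU : W.formalOmega * s * invOfUnit (W.formalOmega * s) 1 = 1 :=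
    mul_invOfUnit _ _ (by rw [hU0, Units.val_one])
  have hV : W.formalOmega * s ^ 2 * invOfUnit (W.formalOmega * s ^ 2) 1 = 1 :=
    mul_invOfUnit _ _ (by rw [hV0, Units.val_one])
  -- `s · V⁻¹ = U⁻¹`
  have hinv : s * invOfUnit (W.formalOmega * s ^ 2) 1 = invOfUnit (W.formalOmega * s) 1 := by
    calc s * invOfUnit (W.formalOmega * s ^ 2) 1
        = (W.formalOmega * s * invOfUnit (W.formalOmega * s) 1) *
            (s * invOfUnit (W.formalOmega * s ^ 2) 1) := by rw [hU, one_mul]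
      _ = invOfUnit (W.formalOmega * s) 1 *
            (W.formalOmega * s ^ 2 * invOfUnit (W.formalOmega * s ^ 2) 1) := by ring
      _ = invOfUnit (W.formalOmega * s) 1 := by rw [hV, mul_one]
  -- `(s²)' = 2 s s'`
  have hder : d⁄dX A (s ^ 2) = 2 * s * d⁄dX A s := by
    rw [pow_two, Derivation.leibniz, smul_eq_mul]; ring
  rw [sigmaSqG, hS, hder, sigmaG, ← hs]
  calc (2 * s ^ 2 + X * (2 * s * d⁄dX A s)) * invOfUnit (W.formalOmega * s ^ 2) 1
      = 2 * (s + X * d⁄dX A s) * (s * invOfUnit (W.formalOmega * s ^ 2) 1) := by ring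
    _ = 2 * ((s + X * d⁄dX A s) * invOfUnit (W.formalOmega * s) 1) := by rw [hinv]; ring

variable {W} in
/-- **A solution of the sigma ODE squares to a solution of the sigma-squared ODE** (`σ(0) = 0`,
`σ'(0) = 1`). [Mazur–Stein–Tate 2006, Thm. 1.3; Silverman 2005, §5 Rem. 2]
[cite: Silverman2005DivPoly, §5 Rem. 2] -/
theorem SatisfiesSigmaODE.sq {σ : A⟦X⟧} {c : A} (h0 : constantCoeff σ = 0) (h1 : coeff 1 σ = 1)
    (h : W.SatisfiesSigmaODE σ c) : W.SatisfiesSigmaSqODE (σ ^ 2) c := by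
  rw [satisfiesSigmaODE_iff] at h
  rw [SatisfiesSigmaSqODE, sigmaSqG_sq h0 h1, h, mul_comm (2 : A⟦X⟧) (W.sigmaG σ), Derivation.leibniz,
    smul_eq_mul, smul_eq_mul]
  have h2 : d⁄dX A (2 : A⟦X⟧) = 0 := by
    rw [show (2 : A⟦X⟧) = ((2 : ℕ) : A⟦X⟧) by norm_cast]
    exact (d⁄dX A).map_natCast 2
  rw [h2, mul_zero, zero_add]
  ring

end RatAlgebra

/-! ### Over `ℚ_p`: squared pairs and THE squared pair -/

section Padic

variable {p : ℕ} [Fact p.Prime] (W : WeierstrassCurve ℚ_[p])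

/-- **A Mazur–Tate sigma-SQUARED pair** `(Σ, c)` for `W/ℚ_p`: `Σ = t² + ⋯ ∈ t²ℤ_p⟦t⟧` (`[t⁰]Σ =
[t¹]Σ = 0`, `[t²]Σ = 1`, all coefficients in `ℤ_p`), `Σ` even (`Σ(i(t)) = Σ(t)`), and the sigma-squared
ODE `2(x + c) = −(d/ω)((1/Σ)(dΣ/ω))` for SOME constant `c ∈ ℚ_p` (no integrality imposed on `c`). This
is Silverman's normalisation «`σ² ∈ z² + z³R⟦z⟧`» of the object that, by Mazur–Tate 1991 Thm. 3.1,
exists uniquely at every good ordinary prime INCLUDING `p = 2` (Silverman 2005 §5 Rem. 2), written —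
like the tree's `IsMazurTateSigmaPair` — through the differential equation of Mazur–Stein–Tate 2006
Thm. 1.3 rather than through division polynomials. [Silverman 2005, §5 Thm. 11 and Rem. 2;
Mazur–Stein–Tate 2006, Thm. 1.3] [cite: Silverman2005DivPoly, §5 Rem. 2]
[cite: MazurSteinTate2006, Thm. 1.3] -/
structure IsMazurTateSigmaSqPair (Sq : ℚ_[p]⟦X⟧) (c : ℚ_[p]) : Prop where
  /-- `Σ(0) = 0`. -/
  constantCoeff_eq : constantCoeff Sq = 0
  /-- `[t¹]Σ = 0`. -/
  coeff_one_eq : coeff 1 Sq = 0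
  /-- `Σ = t² + O(t³)`. -/
  coeff_two_eq : coeff 2 Sq = 1
  /-- `Σ ∈ ℤ_p⟦t⟧`. -/
  norm_coeff_le : ∀ n, ‖coeff n Sq‖ ≤ 1
  /-- `Σ` is even: `Σ(i(t)) = Σ(t)`. -/
  even : W.IsFormallyEven Sq
  /-- `2(x(t) + c) = −(d/ω)((1/Σ)(dΣ/ω))`. -/
  ode : W.SatisfiesSigmaSqODE Sq c

variable {W} in
/-- **A Mazur–Tate pair squares to a sigma-squared pair**: `(σ, c) ↦ (σ², c)` (any prime `p`).
At odd good ordinary `p` this is how the tree's `σ_p` inhabits the squared vocabulary; at `p = 2` with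
`a₁` odd there is no `(σ, c)` to square (`not_exists_isMazurTateSigmaPair_two_of_norm_a₁_eq_one`).
[cite: Silverman2005DivPoly, §5 Thm. 11 and Rem. 2] [cite: MazurSteinTate2006, Thm. 1.3] -/
theorem IsMazurTateSigmaPair.sq {σ : ℚ_[p]⟦X⟧} {c : ℚ_[p]} (h : W.IsMazurTateSigmaPair σ c) :
    W.IsMazurTateSigmaSqPair (σ ^ 2) c where
  constantCoeff_eq := by rw [map_pow, h.constantCoeff_eq, zero_pow two_ne_zero]
  coeff_one_eq := by
    rw [pow_two, coeff_one_mul_eq, coeff_zero_eq_constantCoeff_apply, h.constantCoeff_eq]; ring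
  coeff_two_eq := by
    rw [pow_two, coeff_two_mul_eq, coeff_zero_eq_constantCoeff_apply, h.constantCoeff_eq,
      h.coeff_one_eq]; ring
  norm_coeff_le := isPadicInt_iff_coeff.mp (h.isPadicInt_sigma.pow 2)
  even := h.odd.sq
  ode := h.ode.sq h.constantCoeff_eq h.coeff_one_eq

/-- **THE sigma-squared pair `(Σ_p, c)` of `W/ℚ_p`**: `(σ_p², c_p)` if the Mazur–Tate pair exists
(`padicSigma`, `padicSigmaConst` — every odd good ordinary `p`); otherwise a sigma-squared pair chosen
among those satisfying `IsMazurTateSigmaSqPair` (the `p = 2` good ordinary case, where it is unique by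
Mazur–Tate 1991 Thm. 3.1 / Silverman 2005 Rem. 2 — not asserted here); junk `(t², 0)` if there is
none. [cite: Silverman2005DivPoly, §5 Rem. 2] [cite: MazurSteinTate2006, Thm. 1.3] -/
def mazurTateSqPair : ℚ_[p]⟦X⟧ × ℚ_[p] :=
  if ∃ σc : ℚ_[p]⟦X⟧ × ℚ_[p], W.IsMazurTateSigmaPair σc.1 σc.2 then (W.padicSigma ^ 2, W.padicSigmaConst)
  else if h : ∃ Sc : ℚ_[p]⟦X⟧ × ℚ_[p], W.IsMazurTateSigmaSqPair Sc.1 Sc.2 then h.choose else (X ^ 2, 0)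

/-- **The squared canonical `p`-adic sigma function** `Σ_p(t) = t² + a₁t³ + ⋯ ∈ t²ℤ_p⟦t⟧`
(`= σ_p²` whenever `σ_p` exists). [Silverman 2005, §5 Rem. 2; Mazur–Tate 1991, Thm. 3.1]
[cite: Silverman2005DivPoly, §5 Rem. 2] -/
def padicSigmaSq : ℚ_[p]⟦X⟧ :=
  W.mazurTateSqPair.1

/-- The constant `c` of the squared pair (`= padicSigmaConst` whenever `σ_p` exists).
[cite: MazurSteinTate2006, Thm. 1.3] -/
def padicSigmaSqConst : ℚ_[p] :=
  W.mazurTateSqPair.2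

variable {W} in
/-- With a Mazur–Tate pair at hand, `Σ_p = σ_p²` (first branch of `mazurTateSqPair`).
[cite: Silverman2005DivPoly, §5 Rem. 2] -/
theorem padicSigmaSq_eq_sq_of_exists (h : ∃ σ : ℚ_[p]⟦X⟧, ∃ c : ℚ_[p], W.IsMazurTateSigmaPair σ c) :
    W.padicSigmaSq = W.padicSigma ^ 2 := by
  have h' : ∃ σc : ℚ_[p]⟦X⟧ × ℚ_[p], W.IsMazurTateSigmaPair σc.1 σc.2 := by
    obtain ⟨σ, c, hσ⟩ := h; exact ⟨(σ, c), hσ⟩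
  simp only [padicSigmaSq, mazurTateSqPair, if_pos h']

variable {W} in
/-- With a Mazur–Tate pair at hand, the squared constant is `c_p`. [cite: MazurSteinTate2006, Thm. 1.3] -/
theorem padicSigmaSqConst_eq_of_exists (h : ∃ σ : ℚ_[p]⟦X⟧, ∃ c : ℚ_[p], W.IsMazurTateSigmaPair σ c) :
    W.padicSigmaSqConst = W.padicSigmaConst := by
  have h' : ∃ σc : ℚ_[p]⟦X⟧ × ℚ_[p], W.IsMazurTateSigmaPair σc.1 σc.2 := by
    obtain ⟨σ, c, hσ⟩ := h; exact ⟨(σ, c), hσ⟩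
  simp only [padicSigmaSqConst, mazurTateSqPair, if_pos h']

variable {W} in
/-- **`(Σ_p, c)` IS a sigma-squared pair** as soon as either a Mazur–Tate pair or a sigma-squared pair
exists (first branch: `IsMazurTateSigmaPair.sq`; second branch: choice).
[cite: Silverman2005DivPoly, §5 Rem. 2] [cite: MazurSteinTate2006, Thm. 1.3] -/
theorem isMazurTateSigmaSqPair_padicSigmaSq
    (h : (∃ σ : ℚ_[p]⟦X⟧, ∃ c : ℚ_[p], W.IsMazurTateSigmaPair σ c) ∨
      ∃ Sq : ℚ_[p]⟦X⟧, ∃ c : ℚ_[p], W.IsMazurTateSigmaSqPair Sq c) :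
    W.IsMazurTateSigmaSqPair W.padicSigmaSq W.padicSigmaSqConst := by
  by_cases h₁ : ∃ σc : ℚ_[p]⟦X⟧ × ℚ_[p], W.IsMazurTateSigmaPair σc.1 σc.2
  · have h₁' : ∃ σ : ℚ_[p]⟦X⟧, ∃ c : ℚ_[p], W.IsMazurTateSigmaPair σ c := by
      obtain ⟨σc, hσc⟩ := h₁; exact ⟨σc.1, σc.2, hσc⟩
    rw [padicSigmaSq_eq_sq_of_exists h₁', padicSigmaSqConst_eq_of_exists h₁']
    exact (W.isMazurTateSigmaPair_padicSigma h₁').sq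
  · have h₂ : ∃ Sc : ℚ_[p]⟦X⟧ × ℚ_[p], W.IsMazurTateSigmaSqPair Sc.1 Sc.2 := by
      rcases h with ⟨σ, c, hσ⟩ | ⟨Sq, c, hSq⟩
      · exact absurd ⟨(σ, c), hσ⟩ h₁
      · exact ⟨(Sq, c), hSq⟩
    have e : W.mazurTateSqPair = h₂.choose := by
      simp only [mazurTateSqPair, if_neg h₁, dif_pos h₂]
    rw [padicSigmaSq, padicSigmaSqConst, e]
    exact h₂.choose_spec

variable {W} in
/-- Junk branch: with neither kind of pair, `Σ_p = t²`. [cite: Silverman2005DivPoly, §5 Rem. 2] -/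
theorem padicSigmaSq_eq_X_sq_of_not_exists
    (h₁ : ¬ ∃ σ : ℚ_[p]⟦X⟧, ∃ c : ℚ_[p], W.IsMazurTateSigmaPair σ c)
    (h₂ : ¬ ∃ Sq : ℚ_[p]⟦X⟧, ∃ c : ℚ_[p], W.IsMazurTateSigmaSqPair Sq c) :
    W.padicSigmaSq = X ^ 2 := by
  have h₁' : ¬ ∃ σc : ℚ_[p]⟦X⟧ × ℚ_[p], W.IsMazurTateSigmaPair σc.1 σc.2 :=
    fun ⟨σc, hσc⟩ => h₁ ⟨σc.1, σc.2, hσc⟩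
  have h₂' : ¬ ∃ Sc : ℚ_[p]⟦X⟧ × ℚ_[p], W.IsMazurTateSigmaSqPair Sc.1 Sc.2 :=
    fun ⟨Sc, hSc⟩ => h₂ ⟨Sc.1, Sc.2, hSc⟩
  simp only [padicSigmaSq, mazurTateSqPair, if_neg h₁', dif_neg h₂']

end Padic

/-! ### Over `ℚ`: the sigma-squared form of the canonical `p`-adic height -/

section Rat

variable (W : WeierstrassCurve ℚ) (p : ℕ) [Fact p.Prime]

/-- `Σ_p(t) ∈ ℚ_p` for `t ∈ ℚ_p`: the sum of the squared sigma series of `W ⊗ ℚ_p` (coefficients in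
`ℤ_p`, convergent for `‖t‖ < 1`; `tsum` junk otherwise) — `padicEval` of `padicSigmaSq`.
[cite: Silverman2005DivPoly, §5 Rem. 2] -/
def padicSigmaSqEval (t : ℚ_[p]) : ℚ_[p] :=
  padicEval (W.baseChange ℚ_[p]).padicSigmaSq t

/-- **The canonical `p`-adic height of an admissible point, sigma-SQUARED form**
(Stein–Wuthrich normalisation): `ĥ_p(P) = log_p(den x(P)) − log_p Σ_p(−x/y)` with `Σ_p = σ_p²`
— literally `canonicalPAdicHeight` (`log_p den x − 2 log_p σ_p(z)`) whenever `σ_p` exists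
(`canonicalPAdicHeightSq_eq_of_exists`), and meaningful at a good ordinary `p = 2` as well, where only
`σ²` is defined (Silverman 2005 Rem. 2). Junk off the admissible locus; `0` at `O`.
[Stein–Wuthrich 2013, §4.1 eq. (4.1); Mazur–Stein–Tate 2006, §1 eq. (1.1); Silverman 2005, §5 Rem. 2]
[cite: SteinWuthrich2013, §4.1 eq. (4.1)] [cite: Silverman2005DivPoly, §5 Rem. 2] -/
def canonicalPAdicHeightSq : W.toAffine.Point → ℚ_[p]
  | .zero => 0
  | .some x y _ => padicLog p ((x.den : ℚ) : ℚ_[p]) - padicLog p (W.padicSigmaSqEval p (-(x : ℚ_[p]) / y))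

variable {W p} in
/-- **`D` is THE canonical cyclotomic `p`-adic height pairing, sigma-squared form**: on every admissible
point `⟨P, P⟩_D = log_p den x(P) − log_p Σ_p(z(P))`. Equivalent to `PAdicHeightData.IsCanonical`
whenever the Mazur–Tate pair of `W ⊗ ℚ_p` exists (`isCanonicalSq_iff_isCanonical_of_exists`); the
intended receptacle at a good ordinary `p = 2`, where `IsCanonical` is unsatisfiable
(`CanonicalPAdicHeightTwoJunkProofs.lean`). [Stein–Wuthrich 2013, §4.1 eq. (4.1); Silverman 2005,
§5 Rem. 2] [cite: SteinWuthrich2013, §4.1 eq. (4.1)] [cite: Silverman2005DivPoly, §5 Rem. 2] -/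
def PAdicHeightData.IsCanonicalSq (D : PAdicHeightData W p) : Prop :=
  ∀ P : W.toAffine.Point, W.IsAdmissible p P → D.pairing P P = W.canonicalPAdicHeightSq p P

/-- `ĥ_p(O) = 0` (sigma-squared form; the tree's convention at `O`, as for `canonicalPAdicHeight`).
[cite: SteinWuthrich2013, §4.1 eq. (4.1)] -/
@[simp] theorem canonicalPAdicHeightSq_zero : W.canonicalPAdicHeightSq p 0 = 0 := rfl

variable {W p} in
/-- Unfolding on an affine point. [cite: SteinWuthrich2013, §4.1 eq. (4.1)] -/
theorem canonicalPAdicHeightSq_some {x y : ℚ} (h : W.toAffine.Nonsingular x y) :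
    W.canonicalPAdicHeightSq p (.some x y h) =
      padicLog p ((x.den : ℚ) : ℚ_[p]) - padicLog p (W.padicSigmaSqEval p (-(x : ℚ_[p]) / y)) := rfl

variable {W p} in
/-- **`Σ_p(t) = σ_p(t)²`** for `‖t‖ < 1` whenever the Mazur–Tate pair exists (`Σ_p = σ_p²` has
coefficients in `ℤ_p`; `padicEval_pow`). [cite: Silverman2005DivPoly, §5 Rem. 2] -/
theorem padicSigmaSqEval_eq_sq_of_exists
    (h : ∃ σ : ℚ_[p]⟦X⟧, ∃ c : ℚ_[p], (W.baseChange ℚ_[p]).IsMazurTateSigmaPair σ c)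
    {t : ℚ_[p]} (ht : ‖t‖ < 1) : W.padicSigmaSqEval p t = W.padicSigmaEval p t ^ 2 := by
  rw [padicSigmaSqEval, padicSigmaSq_eq_sq_of_exists h,
    padicEval_pow ((W.baseChange ℚ_[p]).isMazurTateSigmaPair_padicSigma h).isPadicInt_sigma ht 2]
  rfl

variable {W p} in
/-- **The two forms of the sigma formula agree** on points of `E₁(ℚ_p)` whenever the Mazur–Tate pair
exists: `log_p den x − log_p Σ_p(z) = log_p den x − 2 log_p σ_p(z)` (`Σ_p(z) = σ_p(z)²`,
`σ_p(z) ≠ 0` for `0 < ‖z‖ < 1`, `log_p(uv) = log_p u + log_p v`). For a `ℤ`-integral equation and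
`‖x‖_p > 1`. [cite: SteinWuthrich2013, §4.1 eq. (4.1)] [cite: MazurSteinTate2006, §1 eq. (1.1)] -/
theorem canonicalPAdicHeightSq_some_eq_of_exists [W.IsIntegral ℤ]
    (h : ∃ σ : ℚ_[p]⟦X⟧, ∃ c : ℚ_[p], (W.baseChange ℚ_[p]).IsMazurTateSigmaPair σ c)
    {x y : ℚ} (hxy : W.toAffine.Nonsingular x y) (hx : 1 < ‖(x : ℚ_[p])‖) :
    W.canonicalPAdicHeightSq p (.some x y hxy) = W.canonicalPAdicHeight p (.some x y hxy) := by
  obtain ⟨hy0, -, hz1, -⟩ := W.norm_a₁x_add_a₃_div_y_lt_one (p := p) hxy hx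
  have hx0 : (x : ℚ_[p]) ≠ 0 := by
    intro h0; rw [h0, norm_zero] at hx; exact (not_lt.mpr zero_le_one) hx
  have hz1' : ‖-(x : ℚ_[p]) / y‖ < 1 := by rwa [neg_div, norm_neg]
  have hz0 : -(x : ℚ_[p]) / y ≠ 0 := by
    rw [neg_div, neg_ne_zero]; exact div_ne_zero hx0 hy0
  have hσ0 : W.padicSigmaEval p (-(x : ℚ_[p]) / y) ≠ 0 := W.padicSigmaEval_ne_zero p hz0 hz1'
  rw [canonicalPAdicHeightSq_some, canonicalPAdicHeight_some, padicSigmaAt, padicParam_some,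
    padicSigmaSqEval_eq_sq_of_exists h hz1', pow_two, padicLog_mul_holds p hσ0 hσ0, two_mul]

variable {W p} in
/-- **On admissible points the two forms agree** (given the Mazur–Tate pair).
[cite: SteinWuthrich2013, §4.1 eq. (4.1)] -/
theorem canonicalPAdicHeightSq_eq_of_exists [W.IsIntegral ℤ]
    (h : ∃ σ : ℚ_[p]⟦X⟧, ∃ c : ℚ_[p], (W.baseChange ℚ_[p]).IsMazurTateSigmaPair σ c)
    {P : W.toAffine.Point} (hP : W.IsAdmissible p P) :
    W.canonicalPAdicHeightSq p P = W.canonicalPAdicHeight p P := by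
  rcases P with _ | ⟨x, y, hxy⟩
  · rfl
  · exact canonicalPAdicHeightSq_some_eq_of_exists h hxy hP.2.1

variable {W p} in
/-- **`IsCanonicalSq ↔ IsCanonical` whenever the Mazur–Tate pair exists** (every odd good ordinary `p`;
`ℤ`-integral `W`): the squared predicate is a conservative reformulation there.
[cite: SteinWuthrich2013, §4.1 eq. (4.1)] [cite: MazurSteinTate2006, Thm. 1.3] -/
theorem PAdicHeightData.isCanonicalSq_iff_isCanonical_of_exists [W.IsIntegral ℤ]
    (h : ∃ σ : ℚ_[p]⟦X⟧, ∃ c : ℚ_[p], (W.baseChange ℚ_[p]).IsMazurTateSigmaPair σ c)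
    (D : PAdicHeightData W p) : D.IsCanonicalSq ↔ D.IsCanonical := by
  refine ⟨fun hD P hP => ?_, fun hD P hP => ?_⟩
  · rw [hD P hP, canonicalPAdicHeightSq_eq_of_exists h hP]
  · rw [hD P hP, canonicalPAdicHeightSq_eq_of_exists h hP]

end Rat

end WeierstrassCurve

/-! ## §2 (append, ty g8) — `[t³]Σ = a₁` from evenness: the `p = 2` NON-obstruction; the `K`-side predicate -/

namespace WeierstrassCurve

/-! ### Evenness pins `[t³]Σ` (any commutative ring) -/

section RingEven

variable {R : Type*} [CommRing R] (W : WeierstrassCurve R)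

/-- `[t³](i(t)²) = 2a₁` (`i(t) = −t − a₁t² + ⋯`). [Silverman AEC IV.1] [folklore] -/
private theorem coeff_three_formalNeg_sq : coeff 3 (W.formalNeg ^ 2) = 2 * W.a₁ := by
  have h0 : coeff 0 W.formalNeg = 0 := by rw [coeff_zero_eq_constantCoeff]; exact W.constantCoeff_formalNeg
  rw [sq, coeff_mul, Finset.Nat.sum_antidiagonal_eq_sum_range_succ
    (fun i j ↦ coeff i W.formalNeg * coeff j W.formalNeg)]
  simp [Finset.sum_range_succ, h0, W.coeff_one_formalNeg, W.coeff_two_formalNeg]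
  ring

/-- `[t³](i(t)³) = −1`. [Silverman AEC IV.1] [folklore] -/
private theorem coeff_three_formalNeg_cube : coeff 3 (W.formalNeg ^ 3) = -1 := by
  have h0 : coeff 0 W.formalNeg = 0 := by rw [coeff_zero_eq_constantCoeff]; exact W.constantCoeff_formalNeg
  have h00 : coeff 0 (W.formalNeg ^ 2) = 0 := by
    rw [coeff_zero_eq_constantCoeff, map_pow, W.constantCoeff_formalNeg, zero_pow two_ne_zero]
  have h1 : coeff 1 (W.formalNeg ^ 2) = 0 := by
    rw [sq, coeff_one_mul_eq, coeff_zero_eq_constantCoeff_apply, W.constantCoeff_formalNeg]; ring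
  have h2 : coeff 2 (W.formalNeg ^ 2) = 1 := W.coeff_two_formalNeg_sq
  rw [pow_succ, coeff_mul, Finset.Nat.sum_antidiagonal_eq_sum_range_succ
    (fun i j ↦ coeff i (W.formalNeg ^ 2) * coeff j W.formalNeg)]
  simp [Finset.sum_range_succ, h0, h00, h1, h2, W.coeff_one_formalNeg]

variable {W} in
/-- **Evenness pins `[t³]Σ`**: if `Σ = t² + c₃t³ + ⋯` satisfies `Σ(i(t)) = Σ(t)` then `2c₃ = 2a₁`
(comparing `t³`-coefficients: `Σ(i(t)) = t² + (2a₁ − c₃)t³ + ⋯`). The even twin of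
`two_mul_coeff_two_of_isFormallyOdd` (`2[t²]σ = a₁`): for the SQUARED sigma function the leading
correction is `a₁` itself — no division by `2`, which is why `σ² ∈ z² + z³R⟦z⟧` survives at `p = 2`
(Silverman 2005 §5 Rem. 2) while `σ = t + (a₁/2)t² + ⋯` does not.
[cite: Silverman2005DivPoly, §5 Rem. 2] [cite: MazurSteinTate2006, Rem. 1.4] -/
theorem two_mul_coeff_three_of_isFormallyEven {Sq : R⟦X⟧} (heven : W.IsFormallyEven Sq)
    (h0 : constantCoeff Sq = 0) (h1 : coeff 1 Sq = 0) (h2 : coeff 2 Sq = 1) :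
    2 * coeff 3 Sq = 2 * W.a₁ := by
  have h := congrArg (coeff 3) heven
  rw [coeff_subst_eq_sum_range W.constantCoeff_formalNeg, Finset.sum_range_succ,
    Finset.sum_range_succ, Finset.sum_range_succ, Finset.sum_range_succ, Finset.sum_range_zero,
    zero_add, coeff_zero_eq_constantCoeff_apply, h0, mul_zero, zero_add, h1, mul_zero, zero_add, h2,
    mul_one, coeff_three_formalNeg_sq, coeff_three_formalNeg_cube] at h
  linear_combination -h

end RingEven

/-! ### Over `ℚ_p`: `[t³]Σ_p = a₁ ∈ ℤ_p` — no obstruction at `p = 2` -/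

section PadicEven

variable {p : ℕ} [Fact p.Prime] {W : WeierstrassCurve ℚ_[p]}

/-- **`Σ = t² + a₁t³ + ⋯`** for a sigma-squared pair: `[t³]Σ = a₁` (evenness; `2` is invertible in
`ℚ_p`). [cite: Silverman2005DivPoly, §5 Rem. 2] -/
theorem IsMazurTateSigmaSqPair.coeff_three_eq {Sq : ℚ_[p]⟦X⟧} {c : ℚ_[p]}
    (h : W.IsMazurTateSigmaSqPair Sq c) : coeff 3 Sq = W.a₁ :=
  mul_left_cancel₀ (two_ne_zero' ℚ_[p])
    (two_mul_coeff_three_of_isFormallyEven h.even h.constantCoeff_eq h.coeff_one_eq h.coeff_two_eq)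

/-- **A sigma-squared pair only forces `a₁ ∈ ℤ_p`** (`= [t³]Σ`), in contrast with
`IsMazurTateSigmaPair.norm_a₁_le_norm_two` (`‖a₁‖ ≤ ‖2‖`): the squared receptacle carries no `p = 2`
obstruction for `a₁` odd. [cite: Silverman2005DivPoly, §5 Rem. 2] -/
theorem IsMazurTateSigmaSqPair.norm_a₁_le_one {Sq : ℚ_[p]⟦X⟧} {c : ℚ_[p]}
    (h : W.IsMazurTateSigmaSqPair Sq c) : ‖W.a₁‖ ≤ 1 := by
  rw [← h.coeff_three_eq]; exact h.norm_coeff_le 3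

/-- A sigma-squared `Σ` lies in `ℤ_p⟦t⟧`. [cite: Silverman2005DivPoly, §5 Rem. 2] -/
theorem IsMazurTateSigmaSqPair.isPadicInt {Sq : ℚ_[p]⟦X⟧} {c : ℚ_[p]}
    (h : W.IsMazurTateSigmaSqPair Sq c) : IsPadicInt Sq :=
  isPadicInt_iff_coeff.mpr h.norm_coeff_le

end PadicEven

end WeierstrassCurve

/-! ## §3 (append, ty g8) — the sigma-squared form over a number field `K` (`p` totally split) -/

namespace WeierstrassCurve

section NumberField

open NumberField

variable (W : WeierstrassCurve ℚ) (p : ℕ) [Fact p.Prime] (K : Type) [Field K] [NumberField K]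

/-- **The canonical `p`-adic height over `K` of an admissible point, sigma-SQUARED form** (`p` totally
split in `K`; Stein–Wuthrich / `−2p`·MST–BCS normalisation): `ĥ_{p,K}(P) = log_p N(𝔡(x)) −
Σ_{ι : K → ℚ_p} log_p Σ_p(z(ιP))` — literally `canonicalPAdicHeightK` (`… − 2 Σ_ι log_p σ_p(z(ιP))`)
whenever `σ_p` exists (`canonicalPAdicHeightSqK_eq_of_exists`). Junk off the admissible locus.
[Balakrishnan–Çiperiani–Stein 2015, §4.1 eq. (4.1); Silverman 2005, §5 Rem. 2]
[cite: BalakrishnanCiperianiStein2015, §4.1 eq. (4.1)] [cite: Silverman2005DivPoly, §5 Rem. 2] -/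
def canonicalPAdicHeightSqK : (W.baseChange K).toAffine.Point → ℚ_[p]
  | .zero => 0
  | .some x y _ =>
      padicLog p ((Ideal.absNorm (denominatorIdeal K x) : ℚ) : ℚ_[p]) -
        ∑ ι : K →+* ℚ_[p], padicLog p (W.padicSigmaSqEval p (-(ι x) / ι y))

variable {W p K} in
/-- **`DK` is THE canonical cyclotomic `p`-adic height pairing on `E(K)`, sigma-squared form**
(`p` TOTALLY SPLIT in `K`): on every admissible point `⟨P, P⟩ = ĥ^{Σ}_{p,K}(P)`. Equivalent to
`PAdicHeightDataK.IsCanonical` whenever the Mazur–Tate pair of `W ⊗ ℚ_p` exists and `p` is odd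
(`PAdicHeightDataK.isCanonicalSq_iff_isCanonical_of_exists`); the intended receptacle over
`K = ℚ(√−7)` at `p = 2` (split). [Balakrishnan–Çiperiani–Stein 2015, §4.1 eq. (4.1); Silverman 2005,
§5 Rem. 2] [cite: BalakrishnanCiperianiStein2015, §4.1 eq. (4.1)] [cite: Silverman2005DivPoly, §5 Rem. 2] -/
def PAdicHeightDataK.IsCanonicalSq (DK : PAdicHeightDataK W p K) : Prop :=
  Fintype.card (K →+* ℚ_[p]) = Module.finrank ℚ K ∧
    ∀ P : (W.baseChange K).toAffine.Point, W.IsAdmissibleK p K P →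
      DK.pairing P P = W.canonicalPAdicHeightSqK p K P

variable {W p K} in
/-- Unfolding on an affine point. [cite: BalakrishnanCiperianiStein2015, §4.1 eq. (4.1)] -/
theorem canonicalPAdicHeightSqK_some {x y : K} (h : (W.baseChange K).toAffine.Nonsingular x y) :
    W.canonicalPAdicHeightSqK p K (.some x y h) =
      padicLog p ((Ideal.absNorm (denominatorIdeal K x) : ℚ) : ℚ_[p]) -
        ∑ ι : K →+* ℚ_[p], padicLog p (W.padicSigmaSqEval p (-(ι x) / ι y)) := rfl

variable {W p K} in
/-- **The two `K`-forms agree on admissible points** whenever the Mazur–Tate pair exists, `p` odd,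
`ℤ`-integral `W` (`Σ_p(z) = σ_p(z)²`, `σ_p(z(ιP)) ≠ 0`, `log_p(uv) = log_p u + log_p v` per embedding).
[cite: BalakrishnanCiperianiStein2015, §4.1 eq. (4.1)] [cite: MazurSteinTate2006, §1 eq. (1.1)] -/
theorem canonicalPAdicHeightSqK_eq_of_exists [W.IsIntegral ℤ] (hp : p ≠ 2)
    (h : ∃ σ : ℚ_[p]⟦X⟧, ∃ c : ℚ_[p], (W.baseChange ℚ_[p]).IsMazurTateSigmaPair σ c)
    {P : (W.baseChange K).toAffine.Point} (hP : W.IsAdmissibleK p K P) :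
    W.canonicalPAdicHeightSqK p K P = W.canonicalPAdicHeightK p K P := by
  rcases P with _ | ⟨x, y, hxy⟩
  · rfl
  rw [canonicalPAdicHeightSqK_some, canonicalPAdicHeightK_some, Finset.mul_sum]
  congr 1
  refine Finset.sum_congr rfl fun ι _ => ?_
  have hx : 1 < ‖ι x‖ := (hP.2.1 ι).1
  have hdisc : InSigmaDisc p (-ι x / ι y) := (hP.2.1 ι).2
  have hσ0 : W.padicSigmaEval p (-ι x / ι y) ≠ 0 := W.padicSigmaEval_emb_ne_zero K p hp ι hxy hx
  have hz1 : ‖-ι x / ι y‖ < 1 := by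
    unfold InSigmaDisc at hdisc
    refine lt_trans hdisc ?_
    have hp1 : (1 : ℝ) < p := by exact_mod_cast (Fact.out : p.Prime).one_lt
    calc (p : ℝ) ^ (-(1 / ((p : ℝ) - 1))) < (p : ℝ) ^ (0 : ℝ) := by
          rw [Real.rpow_lt_rpow_left_iff hp1, neg_lt_zero]
          exact div_pos one_pos (by linarith)
      _ = 1 := Real.rpow_zero _
  rw [padicSigmaSqEval_eq_sq_of_exists h hz1, pow_two, padicLog_mul_holds p hσ0 hσ0, two_mul]

variable {W p K} in
/-- **`IsCanonicalSq ↔ IsCanonical` over `K`** whenever the Mazur–Tate pair exists (`p` odd,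
`ℤ`-integral `W`). [cite: BalakrishnanCiperianiStein2015, §4.1 eq. (4.1)] [cite: MazurSteinTate2006, Thm. 1.3] -/
theorem PAdicHeightDataK.isCanonicalSq_iff_isCanonical_of_exists [W.IsIntegral ℤ] (hp : p ≠ 2)
    (h : ∃ σ : ℚ_[p]⟦X⟧, ∃ c : ℚ_[p], (W.baseChange ℚ_[p]).IsMazurTateSigmaPair σ c)
    (DK : PAdicHeightDataK W p K) : DK.IsCanonicalSq ↔ DK.IsCanonical := by
  refine ⟨fun hD => ⟨hD.1, fun P hP => ?_⟩, fun hD => ⟨hD.1, fun P hP => ?_⟩⟩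
  · rw [hD.2 P hP, canonicalPAdicHeightSqK_eq_of_exists hp h hP]
  · rw [hD.2 P hP, canonicalPAdicHeightSqK_eq_of_exists hp h hP]

end NumberField

end WeierstrassCurve
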